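import Summits.BirchSwinnertonDyer.BirchSwinnertonDyer.Theorems.KatoDescentPotSupersingularKatoFiniteLevelStrictSurj
import Summits.BirchSwinnertonDyer.BirchSwinnertonDyer.Theorems.KatoDescentPotSupersingularKummerLevelTransport
import Literature.NumberTheory.EllipticCurves.WeilPairingLevelDescent
import HarnessLib

/-!
# Raising the level makes a class unramified: a LOCAL class of `E[p^k]` whose image in `H¹(K_v, E[p^∞])` is unramified becomes
# unramified in `H¹(K_v, E[p^s·p^k])` as soon as `p^s · E[p^∞]^{I_v}` is `p^k`-divisible in `E[p^∞]^{I_v}` (g17's (hN), uniform in `k`)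
# (route `KatoDescentPotSupersingular` / `…Tame…`, crux M = stmt-BirchSwinnertonDyer-19196, U₀-red 19190/19203; route-free helper)

Seat `bsd-potss-rkm` g24 (prover; cell `bsd-potss`), TARGET R283 / wake W-M6 (`--supports …`; closes nothing).  HONEST FRAMING: BSD is not
proved by any of this; nothing is booked; theorems only (no definition, no named fact): a TOOL theorem of local Galois cohomology.

## Why (the sharp companion (ii) of crux M's level-0 ledger)

The Poitou–Tate cokernel count `…KatoSelmerPTCokernel` tests tuples `g = (g_ℓ)`, `g_ℓ ∈ ι_k⁻¹ H¹_ur(ℚ_ℓ, E[p^∞]) ⊆ H¹(ℚ_ℓ, E[p^k])`,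
against the functionals `x ↦ Σ_ℓ ⟨g_ℓ, (desc^♭)_* loc_ℓ x⟩_ℓ`, `x` in the Kummer image.  For `x = red_{p^k} c` with `c ∈ A = H¹(ℤ[1/p],T_pE)`
(unramified at `ℓ`) these functionals VANISH: `⟨g_ℓ, (desc^♭)_* loc red_{p^k} c⟩ = ⟨incl_* g_ℓ, (e^♭)_* loc red_{p^{s+k}} c⟩` (level
adjointness, `red_{p^k} = [p^s]_* red_{p^{s+k}}`) and both arguments on the right are UNRAMIFIED classes of the level-`p^s p^k` modules,
orthogonal by Milne I 2.6 (`UnramifiedSelfDual`, no hypothesis on the inertia action) — PROVIDED `incl_* g_ℓ` is unramified at level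
`p^s p^k`.  The class `g_ℓ` itself need not be unramified (only its image in `E[p^∞]` is); this file shows that pushing it up `s` levels
makes it unramified, for the `s` of g17's bound (hN) (`…KatoFiniteLevelStrictBounds.exists_forall_hN`, independent of `k`).  The cocycle
argument is g17's (`…KatoFiniteLevelStrictSurj`, places `v ∉ P`) made local.

## What

* `map_inclKD_mem_unramifiedSubgroup_of_map_primaryInclusion_mem` — `W` elliptic over a number field `K`, `p` prime, `v` a finite
  place, levels `k`, `s`; (hN) at `v` for `(k, s)`: every `I_v`-fixed `x ∈ E[p^∞]` has an `I_v`-fixed `d` with `p^{k+s} d = p^s x`.  THEN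
  for every `g ∈ H¹(K_v, E[p^k])` with `(ι_k)_* g ∈ H¹_ur(K_v, E[p^∞])`: **`incl_* g ∈ H¹_ur(K_v, E[p^s·p^k])`** (`incl = inclKD W (p^s) (p^k)`).
  PROOF (cocycles): `g = [ψ]`; `ι(ψ τ) = τ·Wpt − Wpt` on `I_v` (X11b `mem_unramifiedSubgroup_one_iff_exists`); `x = p^k Wpt` is
  `I_v`-fixed; (hN) gives `d`; `w = Wpt − d ∈ E[p^{s+k}] = E[p^s p^k]` and `τ w − w = ι(ψ τ)` on `I_v`, read through the injective
  equivariant `J = ι_{s+k} ∘ (E[p^s p^k] ⥲ E[p^{s+k}])`.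

References: R. Greenberg, LNM 1716 (1999), §3 Lemma 3.3 and §5 proof of Prop. 5.8 [GreenbergLNM1716]; J. S. Milne, *ADT* I Thm. 2.6
[MilneADT2006]; K. Kato, Astérisque 295 (2004), §14.8 and proof of Prop. 14.16 (pp. 238–245) [Kato2004Asterisque].
-/

-- the summit and its single problem are both named `BirchSwinnertonDyer` (registry layout D-0017)
set_option linter.dupNamespace false
set_option autoImplicit false

noncomputable section

open scoped Classical ContRepresentation NumberField
open Function Field NumberField IsDedekindDomain WeierstrassCurve
open Literature.NumberTheory.EllipticCurves Literature.NumberTheory.GaloisRepresentations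
  Literature.NumberTheory.GaloisRepresentations.DiscreteGaloisModule Literature.NumberTheory.GaloisCohomology
open Summit.BirchSwinnertonDyer.Rank1Residual.X11b.Levels Summit.BirchSwinnertonDyer.Rank1Residual.X11b.LocBridge
open Summit.BirchSwinnertonDyer.Rank1Residual.GaloisImage

universe u

namespace Summit.BirchSwinnertonDyer.BirchSwinnertonDyer.Theorems.KatoFiniteLevelCount

section LevelRaise

variable {K : Type u} [Field K] [NumberField K] (W : WeierstrassCurve K) (p : ℕ) (s k : ℕ)

/-- **Raising the level by `s` makes `g` unramified.**  `v` a finite place; (hN) at `v` for `(k, s)`; `g ∈ H¹(K_v, E[p^k])` with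
`(ι_k)_* g` unramified in `H¹(K_v, E[p^∞])`.  Then `incl_* g ∈ H¹_ur(K_v, E[p^s·p^k])`, `incl = inclKD W (p^s) (p^k) : E[p^k] ↪ E[p^s p^k]`.
See the module docstring for the cocycle proof. [cite: GreenbergLNM1716, §3 Lemma 3.3 and §5 proof of Prop. 5.8] [cite: MilneADT2006, Ch. I, Thm. 2.6] -/
theorem map_inclKD_mem_unramifiedSubgroup_of_map_primaryInclusion_mem (v : HeightOneSpectrum (𝓞 K))
    (hN : ∀ x : W.geomPrimaryTorsion p,
      (∀ τ ∈ absInertia (v.adicCompletion K), GaloisRep.toLocal v (primaryGaloisModule W p) τ x = x) →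
        ∃ d : W.geomPrimaryTorsion p,
          (∀ τ ∈ absInertia (v.adicCompletion K), GaloisRep.toLocal v (primaryGaloisModule W p) τ d = d) ∧
            p ^ (k + s) • d = p ^ s • x)
    {g : galoisCohomology ((W.torsionGaloisModule ((p ^ k : ℕ) : ℤ)).toLocal (Sum.inr v)) 1}
    (hg : galoisCohomology.map ((primaryInclusion W p k).restrictField (v.adicCompletion K)) 1 g ∈
      unramifiedSubgroup (GaloisRep.toLocal v (primaryGaloisModule W p)) 1) :
    galoisCohomology.map ((inclKD W (p ^ s) (p ^ k)).restrictField (v.adicCompletion K)) 1 g ∈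
      unramifiedSubgroup (GaloisRep.toLocal v (W.torsionGaloisModule ((p ^ s * p ^ k : ℕ) : ℤ))) 1 := by
  -- a cocycle `ψ` for `g`; the pushed cocycles `ψ' = incl ∘ ψ` and `ψι = ι_k ∘ ψ`
  obtain ⟨ψ, rfl⟩ := oneCocycleClass_surjective _ g
  set ψ' := contOneCocycles.pullback (ContinuousMonoidHom.id _)
    (X := DiscreteGaloisModule.toTopRep ((W.torsionGaloisModule ((p ^ k : ℕ) : ℤ)).toLocal (Sum.inr v)))
    (Y := DiscreteGaloisModule.toTopRep ((W.torsionGaloisModule ((p ^ s * p ^ k : ℕ) : ℤ)).toLocal (Sum.inr v)))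
    (TopRep.ofHom ⟨((inclKD W (p ^ s) (p ^ k)).restrictField (Place.Completion (Sum.inr v : Place K))).toContinuousLinearMap,
      ((inclKD W (p ^ s) (p ^ k)).restrictField (Place.Completion (Sum.inr v : Place K))).isIntertwining'⟩) ψ with hψ'
  set ψι := contOneCocycles.pullback (ContinuousMonoidHom.id _)
    (X := DiscreteGaloisModule.toTopRep ((W.torsionGaloisModule ((p ^ k : ℕ) : ℤ)).toLocal (Sum.inr v)))
    (Y := DiscreteGaloisModule.toTopRep ((primaryGaloisModule W p).toLocal (Sum.inr v)))
    (TopRep.ofHom ⟨((primaryInclusion W p k).restrictField (Place.Completion (Sum.inr v : Place K))).toContinuousLinearMap,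
      ((primaryInclusion W p k).restrictField (Place.Completion (Sum.inr v : Place K))).isIntertwining'⟩) ψ with hψι
  have hpush : galoisCohomology.map ((inclKD W (p ^ s) (p ^ k)).restrictField (v.adicCompletion K)) 1 (oneCocycleClass _ ψ) =
      oneCocycleClass _ ψ' := galoisCohomology.map_one_oneCocycleClass _ ψ
  have hpushι : galoisCohomology.map ((primaryInclusion W p k).restrictField (v.adicCompletion K)) 1 (oneCocycleClass _ ψ) =
      oneCocycleClass _ ψι := galoisCohomology.map_one_oneCocycleClass _ ψ
  refine (congrArg (fun y => y ∈ unramifiedSubgroup (GaloisRep.toLocal v (W.torsionGaloisModule ((p ^ s * p ^ k : ℕ) : ℤ))) 1)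
    hpush).mpr ?_
  have hg' := (congrArg (fun y => y ∈ unramifiedSubgroup (GaloisRep.toLocal v (primaryGaloisModule W p)) 1) hpushι).mp hg
  have hψ'_apply : ∀ σ, (ψ'.1 σ : W.geomTorsion ((p ^ s * p ^ k : ℕ) : ℤ)) = inclKD W (p ^ s) (p ^ k) (ψ.1 σ) := fun σ => rfl
  have hψι_apply : ∀ σ, (ψι.1 σ : W.geomPrimaryTorsion p) = primaryInclusion W p k (ψ.1 σ) := fun σ => rfl
  -- the injective equivariant `J = ι_{s+k} ∘ (E[p^s p^k] ⥲ E[p^{s+k}]) : E[p^s p^k] → E[p^∞]`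
  let J : W.geomTorsion ((p ^ s * p ^ k : ℕ) : ℤ) → W.geomPrimaryTorsion p := fun x =>
    primaryInclusion W p (s + k) (W.torsionInclusion (natCast_pow_mul_pow_dvd_natCast_pow_add p s k) x)
  have hJcoe : ∀ x, ((J x : W.geomPrimaryTorsion p) : W.geomPoints) = x := fun x => rfl
  have hJinj : Function.Injective J := fun x y h =>
    Subtype.ext (by rw [← hJcoe x, ← hJcoe y, h])
  have hJadd : ∀ x y, J (x - y) = J x - J y := fun x y => by
    change primaryInclusion W p (s + k) (W.torsionInclusion _ (x - y)) = _
    rw [map_sub, map_sub]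
  have hJincl : ∀ P : W.geomTorsion ((p ^ k : ℕ) : ℤ), J (inclKD W (p ^ s) (p ^ k) P) = primaryInclusion W p k P :=
    fun P => Subtype.ext rfl
  have hJι : ∀ (σ : absoluteGaloisGroup (v.adicCompletion K)) (T : W.geomTorsion ((p ^ s * p ^ k : ℕ) : ℤ)),
      J (GaloisRep.toLocal v (W.torsionGaloisModule ((p ^ s * p ^ k : ℕ) : ℤ)) σ T) =
        GaloisRep.toLocal v (primaryGaloisModule W p) σ (J T) := by
    intro σ T
    have h := (((primaryInclusion W p (s + k)).comp
      (W.torsionInclusion (natCast_pow_mul_pow_dvd_natCast_pow_add p s k))).restrictField (v.adicCompletion K)).isIntertwining σ T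
    rwa [ContinuousRep.toContRepresentation_apply_apply, ContinuousRep.toContRepresentation_apply_apply,
      ContIntertwiningMap.restrictField_apply, ContIntertwiningMap.restrictField_apply] at h
  -- `p^k • (τ Wpt − Wpt) = 0` whenever `ι_k (ψ τ) = τ Wpt − Wpt`
  have hfixW : ∀ (σ : absoluteGaloisGroup (v.adicCompletion K)) (Wpt : W.geomPrimaryTorsion p),
      primaryInclusion W p k (ψ.1 σ) = GaloisRep.toLocal v (primaryGaloisModule W p) σ Wpt - Wpt →
        GaloisRep.toLocal v (primaryGaloisModule W p) σ (p ^ k • Wpt) = p ^ k • Wpt := by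
    intro σ Wpt h
    have h2 : p ^ k • (GaloisRep.toLocal v (primaryGaloisModule W p) σ Wpt - Wpt) = 0 := by
      rw [← h, ← map_nsmul, pow_nsmul_geomTorsion_eq_zero, map_zero]
    rw [smul_sub, ← map_nsmul, sub_eq_zero] at h2
    exact h2
  -- the Kummer witness of the unramified class `ι_k ∘ ψ`
  obtain ⟨Wpt, hW⟩ := (Rank1Residual.X11b.LocBridge.mem_unramifiedSubgroup_one_iff_exists
    (GaloisRep.toLocal v (primaryGaloisModule W p)) ψι).mp hg'
  have hW' : ∀ τ ∈ absInertia (v.adicCompletion K),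
      primaryInclusion W p k (ψ.1 τ) = GaloisRep.toLocal v (primaryGaloisModule W p) τ Wpt - Wpt :=
    fun τ hτ => (hψι_apply τ).symm.trans (hW τ hτ)
  -- `x = p^k Wpt` is `I_v`-fixed; (hN) gives `d`; `Wpt − d ∈ E[p^{s+k}]`
  obtain ⟨d, hd, hdx⟩ := hN (p ^ k • Wpt) fun τ hτ => hfixW τ Wpt (hW' τ hτ)
  have hkill : p ^ (s + k) • (Wpt - d) = 0 := by
    rw [smul_sub, add_comm, hdx, pow_add, mul_smul, smul_comm (p ^ k) (p ^ s) Wpt, sub_self]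
  obtain ⟨w, hw⟩ := exists_primaryInclusion_eq_of_nsmul_eq_zero W p (s + k) (Wpt - d) hkill
  -- the same point at level `p^s · p^k`
  let w' : W.geomTorsion ((p ^ s * p ^ k : ℕ) : ℤ) :=
    ⟨(w : W.geomPoints), W.geomTorsion_le_of_dvd (⟨1, by rw [pow_add, mul_one]⟩ : ((p ^ (s + k) : ℕ) : ℤ) ∣ ((p ^ s * p ^ k : ℕ) : ℤ)) w.2⟩
  have hJw' : J w' = Wpt - d := by rw [← hw]; exact Subtype.ext rfl
  refine (Rank1Residual.X11b.LocBridge.mem_unramifiedSubgroup_one_iff_exists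
    (GaloisRep.toLocal v (W.torsionGaloisModule ((p ^ s * p ^ k : ℕ) : ℤ))) ψ').mpr ⟨w', fun τ hτ => hJinj ?_⟩
  change J (ψ'.1 τ) = J (GaloisRep.toLocal v (W.torsionGaloisModule ((p ^ s * p ^ k : ℕ) : ℤ)) τ w' - w')
  rw [hψ'_apply, hJincl, hJadd, hJι, hJw', map_sub, hd τ hτ, hW' τ hτ]
  abel

end LevelRaise

end Summit.BirchSwinnertonDyer.BirchSwinnertonDyer.Theorems.KatoFiniteLevelCount

end
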